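import Literature.MathematicalPhysics.KineticTheory.FouriersLaw
import Mathlib.MeasureTheory.Measure.Prod
import Mathlib.MeasureTheory.Measure.Lebesgue.Basic
import Mathlib.Analysis.SpecialFunctions.Exp
import HarnessLib

/-!
# Non-equilibrium steady states of the Langevin-driven pinned chain (named facts)

Trunk T-KINETIC (Literature/MathematicalPhysics/KineticTheory). Named facts (sorry-free `def … :
Prop`, to be taken as hypotheses `(h : FactName)`) recording the printed existence theory of the
non-equilibrium steady state of the chain `Literature.HeatConduction.pinnedChain ω₂ lam β γ` of
`FouriersLaw.lean`, for the route `AtomisticToContinuum/FourierGreenKubo` (items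
`fourier_ness_exists_unique`, `fourier_finite_response`).

## Source

Cuneo–Eckmann–Hairer–Rey-Bellet, *Non-equilibrium steady states for networks of oscillators*,
Electron. J. Probab. 23 (2018) no. 55 (arXiv:1712.09413), Theorem 2.13 (p. 9):

"1. Under Conditions C1, C2 and CA, the system (2.2) admits at most one invariant measure, and
if it exists, it has a smooth density with respect to Lebesgue measure.
 2. Under Conditions C1, C3, C4 and C5, the system (2.2) admits at least one invariant measure,
and `e^{ϑH}` is integrable with respect to it for all `0 < ϑ < 1/T_max`, with
`T_max = max{T_b : b ∈ B}`.
 3. Finally, assuming Conditions C1–C5, the system (2.2) admits a unique invariant measure `μ⋆`.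
Moreover [exponential convergence (2.5)]."

Here (2.2) is the Langevin system `dq_v = p_v dt`,
`dp_v = -∇_{q_v}H dt + 1_{v∈B}(-γ_v p_v dt + √(2γ_v T_v) dW_v)` (their eq. (2.2), (3.1)), whose
generator (their eq. (3.2)) is `OscillatorChain.generator` of `FouriersLaw.lean` for the path
graph `G = {0,…,N-1}`, `B = {0, N-1}`, `γ_v = γ`. For `pinnedChain ω₂ lam β γ` with
`ω₂, lam, β, γ > 0` and `N ≥ 1` the conditions hold: C1 (p. 4: the path graph is connected and
its two ends control it), C2 (Example 2.5/`V'' = 1 + 3βr² ≥ 1`), C3 (p. 8: `U`, `V` nearly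
homogeneous of degrees `ℓ_p = ℓ_i = 4`, coercive), C4 (Remark 2.10: automatic for `n = 1`),
C5 (`ℓ_i = 4 ≥ ℓ_p = 4`). Earlier versions: Rey-Bellet–Thomas 2002 (CMP 225), Carmona 2007.

## What is vendored, and what is NOT

* `CuneoEckmannHairerReyBellet2018_pinnedChain` — the WEAK-STATIONARITY COROLLARY of parts 2–3:
  an invariant probability measure `μ⋆` of the Feller semigroup with `e^{ϑH} ∈ L¹(μ⋆)` satisfies
  `∫ L f dμ⋆ = 0` for `f ∈ C_c^∞` (Itô/Dynkin: `P_t f - f = ∫₀ᵗ P_s(Lf) ds`, integrate against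
  `μ⋆`) and integrates every polynomial observable (bounded by `C e^{ϑH}`), in particular the bond
  currents; with part 1 it is absolutely continuous. So: for all `N ≥ 1`, `T_L, T_R > 0` there
  EXISTS `μ` with `IsSteadyState N T_L T_R μ`, `μ ≪ Lebesgue`, and `e^{ϑH} ∈ L¹(μ)` for
  `0 < ϑ < 1/max(T_L,T_R)`. This is WEAKER than the printed statement (which is about the
  invariant measure of the Markov semigroup, an object not in the tree) and is what item
  `fourier_ness_exists_unique` needs for its existence half.
* NOT vendored: UNIQUENESS. The printed uniqueness (part 1/3) is among invariant measures of the
  semigroup `P_t`; item `fourier_ness_exists_unique` asks uniqueness among ALL weak stationary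
  probability solutions of `L*μ = 0` with integrable currents (`IsSteadyState`), which is a
  priori STRONGER: it needs "distributional stationary probability solution ⇒ invariant for
  `P_t`" for this hypoelliptic operator with unbounded (cubic) drift (smooth density by
  Hörmander; then a Liouville/Echeverría-type argument with the Lyapunov function `e^{ϑH}`;
  cf. Bogachev–Krylov–Röckner–Shaposhnikov, *Fokker–Planck–Kolmogorov equations*, AMS Surveys 207
  (2015), Ch. 4–5, where uniqueness of probability solutions is proved under non-degeneracy).
  No printed theorem covering the degenerate Langevin chain in this class was found; the gap is
  recorded on the ledger item, not papered over here.
* NOT vendored: the finite-volume Green–Kubo formula (Rey-Bellet, *Statistical mechanics of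
  anharmonic lattices*, arXiv:math-ph/0303021, Remark 4.4 eq. (56); Rey-Bellet–Thomas, AHP 3
  (2002) 483) — it is stated for the semigroup `T₀ᵗ` at equilibrium, not expressible without the
  Markov semigroup of the chain.
-/

noncomputable section

open MeasureTheory

namespace Literature.MathematicalPhysics.KineticTheory.HeatConduction

/-- **Cuneo–Eckmann–Hairer–Rey-Bellet 2018, Theorem 2.13 (weak-stationarity corollary, pinned
chain).** For the pinned anharmonic chain `pinnedChain ω₂ lam β γ` (`U(q) = ω₂q²/2 + lam q⁴/4`,
`V(r) = r²/2 + βr⁴/4`) with `ω₂, lam, β, γ > 0`, every length `N ≥ 1` and all bath temperatures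
`T_L, T_R > 0`, there is a probability measure `μ` on phase space which (i) is a steady state in
the weak Fokker–Planck sense of `OscillatorChain.IsSteadyState` (`∫ L f dμ = 0` for all smooth
compactly supported `f`, bond currents integrable), (ii) is absolutely continuous with respect to
Lebesgue measure ("it has a smooth density with respect to Lebesgue measure"), and (iii)
integrates `e^{ϑH}` for every `0 < ϑ < 1/max(T_L, T_R)` ("`e^{ϑH}` is integrable with respect to
it for all `0 < ϑ < 1/T_max`"). Printed for the unique invariant measure `μ⋆` of the Langevin
system (2.2) under C1–C5, which `pinnedChain` with positive parameters satisfies (path graph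
controlled by its ends; `V'' ≥ 1`; degrees `ℓ_i = ℓ_p = 4`; `n = 1`); the weak stationarity of
`μ⋆` is the Itô/Dynkin identity `∫ (P_t f - f) dμ⋆ = ∫₀ᵗ ∫ P_s(Lf) dμ⋆ ds = 0`. UNIQUENESS in
the class `IsSteadyState` is NOT part of this fact (see the module docstring).
[cite: CuneoEckmannHairerReyBellet2018, Thm 2.13] -/
def CuneoEckmannHairerReyBellet2018_pinnedChain : Prop :=
  ∀ ω₂ lam β γ : ℝ, 0 < ω₂ → 0 < lam → 0 < β → 0 < γ →
    ∀ (N : ℕ) (T_L T_R : ℝ), 0 < N → 0 < T_L → 0 < T_R →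
      ∃ μ : Measure (PhaseSpace N),
        (pinnedChain ω₂ lam β γ).IsSteadyState N T_L T_R μ ∧
        μ ≪ (volume : Measure (PhaseSpace N)) ∧
        ∀ ϑ : ℝ, 0 < ϑ → ϑ < 1 / max T_L T_R →
          Integrable (fun x => Real.exp (ϑ * (pinnedChain ω₂ lam β γ).hamiltonian N x)) μ

/-- Unfolding: the fact yields a weak steady state for every `N ≥ 1`. [folklore] -/
theorem CuneoEckmannHairerReyBellet2018_pinnedChain.exists_isSteadyState
    (h : CuneoEckmannHairerReyBellet2018_pinnedChain) {ω₂ lam β γ : ℝ}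
    (hω : 0 < ω₂) (hl : 0 < lam) (hβ : 0 < β) (hγ : 0 < γ)
    {N : ℕ} (hN : 0 < N) {T_L T_R : ℝ} (hL : 0 < T_L) (hR : 0 < T_R) :
    ∃ μ : Measure (PhaseSpace N), (pinnedChain ω₂ lam β γ).IsSteadyState N T_L T_R μ := by
  obtain ⟨μ, hμ, -, -⟩ := h ω₂ lam β γ hω hl hβ hγ N T_L T_R hN hL hR
  exact ⟨μ, hμ⟩

/-- The empty chain (`N = 0`) has the point mass as a weak steady state: phase space is a
single point, the generator vanishes on it and there are no bonds. Together with the fact above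
this covers all `N`. [folklore] -/
theorem OscillatorChain.isSteadyState_zero (P : OscillatorChain) (T_L T_R : ℝ) :
    P.IsSteadyState 0 T_L T_R (Measure.dirac default) := by
  refine ⟨inferInstance, ?_, fun i => i.elim0⟩
  intro f _ _
  simp [OscillatorChain.generator]

end Literature.MathematicalPhysics.KineticTheory.HeatConduction
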